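import Literature.MathematicalPhysics.QuantumFieldTheory.King1986.CovarianceSplittingUnits
import HarnessLib

/-!
# King 1986, (2.20) bookkeeping: tori with coordinatewise EQUAL periods are canonically the same — the re-indexing
# `torCongr : Tor K ≃ Tor K′` (`K μ = K′ μ`), and the invariance of `c(−Δ) + m²`, of the block structure, of `A₀` and of
# King's constrained propagator `G^ε_k = N^d·A₀⁻¹` under it

**Citation header (fifth file of the `CovarianceSplitting` group; seat `pub-ymgap-dag-n15-e` (generation 5) of the cell
`pub-ymgap`, Track-A node N15 = NE2, King-model rung).**  C. King, *The U(1) Higgs model. I. The continuum limit*, Commun. Math.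
Phys. **102** (1986) 649–677 [King1986], (2.20) p. 654 («how operators transform under rescalings of the lattice»), (2.13) p. 653.
This is pure index bookkeeping: the tree spells one and the same torus `Π_μ ℤ∕K_μ` in several ways — `fine (N·L) M`,
`fine N (fine L M)` (`CovarianceSplittingUnits.flatten`), `fine L (fun _ ↦ 2L^e)` versus `fun _ ↦ 2L^{e+1}`, `fine (L^nL^k) M` versus
`fine (L^{k+n}) M` — and King's operators, being defined through the VALUES of the coordinates, do not see the spelling.  `flatten` is the
special case `K = fine N (fine L M)`, `K′ = fine (N·L) M`.

**What this file PROVES (kernel).**  `torCongr h : Tor K ≃ Tor K′` for `h : ∀ μ, K μ = K′ μ` (coordinatewise `ZMod.ringEquivCongr`);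
`val_torCongr`, `torCongr_add`, `torCongr_sub`, `torCongr_unitVec`, `torCongr_refl`, **`tdistT_torCongr`**; **`lapF_torCongr`** (`c(−Δ) + m²` is invariant); for block structures
`K = fine N M`, `K′ = fine N M′` with `hM : ∀ μ, M μ = M′ μ`: `fineCongr` (the induced equality of fine periods), **`blockOf_torCongr`**,
**`blockProj_torCongr`**, **`fineOp_eq_reindex_torCongr`**, **`constrainedProp_torCongr`** (`G^ε_k(e x, e y) = G^ε_k(x, y)`), `constrainedProp_congrN` (spelling of `N`), and the same one
level up for the nested objects of `CovarianceSplitting`: `blockProj₂_torCongr`, **`constrainedProp₂_torCongr`**.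

HONEST FRAMING: bookkeeping on finite tori; nothing about Bałaban's covariant objects; nothing continuum ∕ mass-gap ∕ Clay; count-neutral.
-/

noncomputable section

open Finset Real Matrix
open scoped BigOperators

namespace Literature.MathematicalPhysics.QuantumFieldTheory.King1986

open Literature.MathematicalPhysics.QuantumFieldTheory.Balaban1983to89
open Literature.MathematicalPhysics.QuantumFieldTheory.Balaban1983to89.B5Prop11Plancherel

namespace Torus

variable {d : ℕ}

/-! ## §1 `torCongr` and the invariance of `c(−Δ) + m²` -/

section General

variable {K K' : Fin d → ℕ}

/-- THE CANONICAL IDENTIFICATION of `Π_μ ℤ∕K_μ` and `Π_μ ℤ∕K′_μ` when `K μ = K′ μ` for every `μ` (coordinatewise `ZMod.ringEquivCongr`).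
[cite: King1986, (2.20) p.654] -/
def torCongr (h : ∀ μ, K μ = K' μ) : Tor K ≃ Tor K' :=
  Equiv.piCongrRight fun μ => (ZMod.ringEquivCongr (h μ)).toEquiv

/-- Coordinate form. [cite: King1986, (2.20) p.654] -/
theorem torCongr_apply (h : ∀ μ, K μ = K' μ) (x : Tor K) (μ : Fin d) :
    torCongr h x μ = ZMod.ringEquivCongr (h μ) (x μ) := rfl

/-- `torCongr` preserves the integer representatives. [cite: King1986, (2.20) p.654] -/
theorem val_torCongr (h : ∀ μ, K μ = K' μ) (x : Tor K) (μ : Fin d) : (torCongr h x μ).val = (x μ).val := by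
  rw [torCongr_apply, ZMod.ringEquivCongr_val]

/-- `torCongr` is additive. [cite: King1986, (2.20) p.654] -/
theorem torCongr_add (h : ∀ μ, K μ = K' μ) (x y : Tor K) : torCongr h (x + y) = torCongr h x + torCongr h y := by
  funext μ
  rw [Pi.add_apply, torCongr_apply, torCongr_apply, torCongr_apply, Pi.add_apply, map_add]

/-- `torCongr` respects subtraction. [cite: King1986, (2.20) p.654] -/
theorem torCongr_sub (h : ∀ μ, K μ = K' μ) (x y : Tor K) : torCongr h (x - y) = torCongr h x - torCongr h y := by
  funext μ
  rw [Pi.sub_apply, torCongr_apply, torCongr_apply, torCongr_apply, Pi.sub_apply, map_sub]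

/-- `torCongr` carries lattice unit vectors to lattice unit vectors. [cite: King1986, (2.20) p.654] -/
theorem torCongr_unitVec (h : ∀ μ, K μ = K' μ) (μ : Fin d) : torCongr h (unitVec K μ) = unitVec K' μ := by
  funext ν
  rw [torCongr_apply, unitVec, unitVec]
  by_cases hν : ν = μ
  · subst hν
    rw [Pi.single_eq_same, Pi.single_eq_same, map_one]
  · rw [Pi.single_eq_of_ne hν, Pi.single_eq_of_ne hν, map_zero]

/-- Along the trivial equality `torCongr` is the identity (`ZMod.ringEquivCongr rfl = refl`). [cite: King1986, (2.20) p.654] -/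
theorem torCongr_refl (h : ∀ μ, K μ = K μ) (x : Tor K) : torCongr h x = x := by
  funext μ
  rw [torCongr_apply, ZMod.ringEquivCongr_refl_apply]

/-- **The torus distance does not see the spelling of the periods.** [cite: King1986, (2.20) p.654] -/
theorem tdistT_torCongr [∀ μ, NeZero (K μ)] [∀ μ, NeZero (K' μ)] (h : ∀ μ, K μ = K' μ) (x y : Tor K) :
    tdistT K' (torCongr h x) (torCongr h y) = tdistT K x y := by
  obtain rfl : K = K' := funext h
  rw [torCongr_refl, torCongr_refl]

/-- **`c(−Δ) + m²` does not see the spelling of the periods.** [cite: King1986, (2.20) p.654, (4.4) p.670] -/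
theorem lapF_torCongr [∀ μ, NeZero (K μ)] [∀ μ, NeZero (K' μ)] (h : ∀ μ, K μ = K' μ) (c m2 : ℝ) (x y : Tor K) :
    lapF K' c m2 (torCongr h x) (torCongr h y) = lapF K c m2 x y := by
  simp only [lapF, ← torCongr_unitVec h, ← torCongr_add, ← torCongr_sub, (torCongr h).injective.eq_iff]

end General

/-! ## §2 Block structures `fine N M` versus `fine N M′` with `M μ = M′ μ` -/

section Blocks

variable (N : ℕ) [NeZero N] {M M' : Fin d → ℕ} [hM : ∀ μ, NeZero (M μ)] [hM' : ∀ μ, NeZero (M' μ)]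

omit [NeZero N] hM hM' in
/-- The induced equality of the fine periods. [cite: King1986, (2.20) p.654] -/
theorem fineCongr (h : ∀ μ, M μ = M' μ) : ∀ μ, fine N M μ = fine N M' μ := fun μ => by
  show N * M μ = N * M' μ; rw [h μ]

/-- **Blocks correspond**: the `N`-block of the re-indexed fine point is the re-indexed `N`-block. [cite: King1986, (2.10) p.653, (2.20) p.654] -/
theorem blockOf_torCongr (h : ∀ μ, M μ = M' μ) (x : Tor (fine N M)) :
    blockOf N M' (torCongr (fineCongr N h) x) = torCongr h (blockOf N M x) := by
  funext μ
  apply ZMod.val_injective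
  rw [val_blockOf, val_torCongr, val_torCongr, val_blockOf]

/-- **The block projector is invariant**: `blockProj N M′ (e x) (e y) = blockProj N M x y`. [cite: King1986, (2.13) p.653, (2.20) p.654] -/
theorem blockProj_torCongr (h : ∀ μ, M μ = M' μ) (x y : Tor (fine N M)) :
    blockProj N M' (torCongr (fineCongr N h) x) (torCongr (fineCongr N h) y) = blockProj N M x y := by
  have key : blockOf N M' (torCongr (fineCongr N h) x) = blockOf N M' (torCongr (fineCongr N h) y)
      ↔ blockOf N M x = blockOf N M y := by
    rw [blockOf_torCongr N h, blockOf_torCongr N h, (torCongr h).injective.eq_iff]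
  unfold blockProj
  by_cases hb : blockOf N M x = blockOf N M y
  · rw [if_pos hb, if_pos (key.mpr hb)]
  · rw [if_neg hb, if_neg (fun h' => hb (key.mp h'))]

/-- **`A₀` is the re-indexed `A₀`.** [cite: King1986, (2.13) p.653, (2.20) p.654] -/
theorem fineOp_eq_reindex_torCongr (h : ∀ μ, M μ = M' μ) (a c m2 : ℝ) :
    fineOp N M' a c m2 = Matrix.reindex (torCongr (fineCongr N h)) (torCongr (fineCongr N h)) (fineOp N M a c m2) := by
  ext i j
  obtain ⟨x, rfl⟩ := (torCongr (fineCongr N h)).surjective i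
  obtain ⟨y, rfl⟩ := (torCongr (fineCongr N h)).surjective j
  rw [Matrix.reindex_apply, Matrix.submatrix_apply, Equiv.symm_apply_apply, Equiv.symm_apply_apply, fineOp, fineOp,
    Matrix.add_apply, Matrix.add_apply, Matrix.smul_apply, Matrix.smul_apply, lapF_torCongr (fineCongr N h),
    blockProj_torCongr N h]

/-- **KING'S `G^ε_k` DOES NOT SEE THE SPELLING OF THE UNIT LATTICE**: `constrainedProp N M′ a c m² (e x) (e y) = constrainedProp N M a c m² x y`.
[cite: King1986, (2.13) p.653, (2.20) p.654] -/
theorem constrainedProp_torCongr (h : ∀ μ, M μ = M' μ) (a c m2 : ℝ) (x y : Tor (fine N M)) :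
    constrainedProp N M' a c m2 (torCongr (fineCongr N h) x) (torCongr (fineCongr N h) y) = constrainedProp N M a c m2 x y := by
  rw [constrainedProp, constrainedProp, Matrix.smul_apply, Matrix.smul_apply, fineOp_eq_reindex_torCongr N h,
    Matrix.inv_reindex, Matrix.reindex_apply, Matrix.submatrix_apply, Equiv.symm_apply_apply, Equiv.symm_apply_apply]

/-- **`G^ε_k` does not see the spelling of the NUMBER OF FINE POINTS PER BLOCK either** (`N = N′` as numbers, e.g. `L^nL^k` vs `L^{k+n}`,
`L^n(L^kL)` vs `(L^nL^k)L`): transport along the induced `torCongr`. [cite: King1986, (2.13) p.653, (2.20) p.654] -/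
theorem constrainedProp_congrN {N' : ℕ} [NeZero N'] (hN : N = N') (M : Fin d → ℕ) [∀ μ, NeZero (M μ)] (a c m2 : ℝ)
    (x y : Tor (fine N M)) :
    constrainedProp N' M a c m2
        (torCongr (K := fine N M) (K' := fine N' M) (fun μ => by rw [hN]) x)
        (torCongr (K := fine N M) (K' := fine N' M) (fun μ => by rw [hN]) y)
      = constrainedProp N M a c m2 x y := by
  subst hN
  rw [torCongr_refl, torCongr_refl]

end Blocks

/-! ## §3 One level up: the nested objects of `CovarianceSplitting` -/

section Nested

variable (N L : ℕ) [NeZero N] [NeZero L] {M M' : Fin d → ℕ} [hM : ∀ μ, NeZero (M μ)] [hM' : ∀ μ, NeZero (M' μ)]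

/-- The composite projector is invariant. [cite: King1986, (2.13) p.653, (2.20) p.654] -/
theorem blockProj₂_torCongr (h : ∀ μ, M μ = M' μ) (x y : Tor (fine N (fine L M))) :
    blockProj₂ N L M' (torCongr (fineCongr N (fineCongr L h)) x) (torCongr (fineCongr N (fineCongr L h)) y)
      = blockProj₂ N L M x y := by
  have key : blockOf L M' (blockOf N (fine L M') (torCongr (fineCongr N (fineCongr L h)) x))
        = blockOf L M' (blockOf N (fine L M') (torCongr (fineCongr N (fineCongr L h)) y))
      ↔ blockOf L M (blockOf N (fine L M) x) = blockOf L M (blockOf N (fine L M) y) := by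
    rw [blockOf_torCongr N (fineCongr L h), blockOf_torCongr N (fineCongr L h), blockOf_torCongr L h,
      blockOf_torCongr L h, (torCongr h).injective.eq_iff]
  rw [blockProj₂_apply, blockProj₂_apply]
  by_cases hb : blockOf L M (blockOf N (fine L M) x) = blockOf L M (blockOf N (fine L M) y)
  · rw [if_pos hb, if_pos (key.mpr hb)]
  · rw [if_neg hb, if_neg (fun h' => hb (key.mp h'))]

/-- **The level-`(k+1)` propagator of the splitting does not see the spelling of the unit lattice**:
`constrainedProp₂ N L M′ … (e x) (e y) = constrainedProp₂ N L M … x y`. [cite: King1986, (2.13)/(2.17) p.653, (2.20) p.654] -/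
theorem constrainedProp₂_torCongr (h : ∀ μ, M μ = M' μ) (a₁ a c m2 : ℝ) (x y : Tor (fine N (fine L M))) :
    constrainedProp₂ N L M' a₁ a c m2 (torCongr (fineCongr N (fineCongr L h)) x) (torCongr (fineCongr N (fineCongr L h)) y)
      = constrainedProp₂ N L M a₁ a c m2 x y := by
  set e := torCongr (fineCongr N (fineCongr L h)) with he
  have hre : lapF (fine N (fine L M')) c m2 + (nextLevelCoeff a a₁ L) • blockProj₂ N L M'
      = Matrix.reindex e e (lapF (fine N (fine L M)) c m2 + (nextLevelCoeff a a₁ L) • blockProj₂ N L M) := by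
    ext i j
    obtain ⟨x, rfl⟩ := e.surjective i
    obtain ⟨y, rfl⟩ := e.surjective j
    rw [Matrix.reindex_apply, Matrix.submatrix_apply, Equiv.symm_apply_apply, Equiv.symm_apply_apply, Matrix.add_apply,
      Matrix.add_apply, Matrix.smul_apply, Matrix.smul_apply, he, lapF_torCongr (fineCongr N (fineCongr L h)),
      blockProj₂_torCongr N L h]
  rw [constrainedProp₂, constrainedProp₂, Matrix.smul_apply, Matrix.smul_apply, hre, Matrix.inv_reindex, Matrix.reindex_apply,
    Matrix.submatrix_apply, Equiv.symm_apply_apply, Equiv.symm_apply_apply]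

end Nested

end Torus

end Literature.MathematicalPhysics.QuantumFieldTheory.King1986
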